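import Summits.ValiantsHypothesis.ValiantsHypothesis.Theorems.BarrierLeverPartitionMinorsHitByVPMooreBallBall

/-!
# Route BarrierLever — item `PartitionMinorsHitByVP` (stmt-ValiantsHypothesis-19717):
# the FIRST-ORDER PEEL for an ARBITRARY column family — the two-storey coefficient (structure theorem)

Helper file (`--supports stmt-ValiantsHypothesis-19717`; cell valiant-natproofs, rung V4, 𝒟-side door (c); prover
seat val-np-p6 gen 6). Definition-free. Closes NO item. Sequel of `…HitByVPMooreBallBall` (same seat), which peeled
the ball × ball Moore determinant; here the column family is ARBITRARY (rows still the Hamming ball), which is what the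
conjecture of record F_3 (`MooreBallNonsingularChar 3 h e`, all `h e`) needs.

SETTING. Rows `S ∈ B([n+1], e+1)` (the type `Ball (n+1) (e+1)`), node forms `η_S = ballEta p (n+1) S`; column `j`
carries an arbitrary digit set `W j ⊆ Fin k` with weight `m(W j) = Σ_{x ∈ W j} p^{d x}` for an arbitrary exponent map
`d : Fin k → ℕ`. Split the columns by a threshold `D`: a column is LOW (`j ∈ low`) if `W j = {c j} ⊔ T j` with
`d (c j) ≤ D` and all digits of the tail `T j` strictly above `d (c j)` (so `p^{d(c j)+1} ∣ m(T j)`), and HIGH otherwise,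
all its digits having exponent `> D` (so `p^{D+1} ∣ m(W j)`). Peel the node `0` (`T :=` its variable; the other node
variables and the constant variable stay): subtract row `S'` from row `S' ∪ {0}`; by Frobenius the differenced entry is
`T^{p^{d(c j)}}·(η_{S'}^{m(T j)} + T·g)` on a low column and `≡ 0 (mod T^{p^D + 1})` on a high column. Rescaling rows
(plain rows by `T^{p^D}`) and columns (low `j` by `T^{p^{d(c j)}}`, high by `T^{p^D}`) — all exponents nonnegative —
turns the matrix into `N'` with `T^{p^D·|B(n,e+1)|} · det = det N' · T^{Σ_j v_j}` and `N'(0) =` the **TWO-STOREY MATRIX**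

  `M̂[inl S, j] = η_S^{m(W j)}` if `j` is high or (`j` low with `d (c j) = D`), else `0`   (plain storey, `S ∈ B([n], e+1)`),
  `M̂[inr S', j] = η_{S'}^{m(T j)}` if `j` is low, else `0`                               (difference storey, `S' ∈ B([n], e)`).

* **`det_ne_zero_of_twoStorey`** — if `det M̂ ≠ 0` (columns re-indexed by `ballSplit` to make it square) then the
  Moore–ball determinant `det [η_S^{m(W j)}]` is nonzero. When the low columns are exactly `|B(n,e)|` many («no tie»)
  and sit on ONE level `D`, `M̂` is block-triangular and the statement is the Pascal peel of `…MooreBallBall`; in general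
  (ties) `M̂` is GLUED and its determinant is the object the cell's Conjecture M̂ (memo RESIDUE-v8 §3) is about:
  kit j287869 — for every down-closed column family at `(h,e) = (5,2), (5,3), (6,2)` (621 / 61 / 144 505 families) and
  20 000 sampled at `(6,3)`, `det M̂ = 0` happens exactly when the difference storey has fewer than `|B(n,e)|` distinct
  tail columns, and F_3 itself never fails there.

WHAT THIS IS NOT: a structure theorem (an implication), no new unconditional layout class; the lowest-order coefficient
can vanish (then the true order is higher and this lemma says nothing); nothing on crux 14610 or VP vs VNP.
-/

set_option linter.dupNamespace false

namespace Summit.ValiantsHypothesis.ValiantsHypothesis.Theorems.BarrierLever.FrobeniusDoor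

open Finset MvPolynomial Matrix

noncomputable section

variable (p : ℕ) [Fact p.Prime]

/-- **THE FIRST-ORDER PEEL, ARBITRARY COLUMNS.** See the module docstring: if the two-storey matrix `M̂` (plain storey
on the high columns and the low columns of the top level `D`, difference storey = tails of the low columns) has nonzero
determinant, so has the Moore–ball matrix `[η_S^{m(W j)}]_{S, j ∈ B([n+1], e+1)}`. -/
theorem det_ne_zero_of_twoStorey (n e k : ℕ) (d : Fin k → ℕ) (W : Ball (n + 1) (e + 1) → Finset (Fin k)) (D : ℕ)
    (low : Finset (Ball (n + 1) (e + 1))) (c : Ball (n + 1) (e + 1) → Fin k)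
    (T : Ball (n + 1) (e + 1) → Finset (Fin k))
    (hlow : ∀ j ∈ low, W j = insert (c j) (T j) ∧ c j ∉ T j ∧ d (c j) ≤ D ∧ ∀ x ∈ T j, d (c j) < d x)
    (hhigh : ∀ j ∉ low, ∀ x ∈ W j, D < d x)
    (hM : ((Matrix.of fun (i : Ball n (e + 1) ⊕ Ball n e) (j : Ball (n + 1) (e + 1)) =>
        Sum.elim (fun S : Ball n (e + 1) =>
            if j ∉ low ∨ d (c j) = D then ballEta p n S.1 ^ ballWt p k d (W j) else 0)
          (fun S' : Ball n e => if j ∈ low then ballEta p n S'.1 ^ ballWt p k d (T j) else 0) i).submatrix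
        id (ballSplit n e).symm).det ≠ 0) :
    (Matrix.of fun S j : Ball (n + 1) (e + 1) => ballEta p (n + 1) S.1 ^ ballWt p k d (W j)).det ≠ 0 := by
  classical
  set ψ := MvPolynomial.finSuccEquiv (ZMod p) (n + 1) with hψ
  set σ := ballSplit n e with hσ
  set P : ℕ := p ^ D with hP
  set M : Matrix (Ball (n + 1) (e + 1)) (Ball (n + 1) (e + 1)) (MvPolynomial (Fin (n + 1 + 1)) (ZMod p)) :=
    Matrix.of fun S j => ballEta p (n + 1) S.1 ^ ballWt p k d (W j) with hMdef
  -- weights of the columns (as seen through `σ`) and the high/low digit arithmetic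
  let Wc : Ball n (e + 1) ⊕ Ball n e → Finset (Fin k) := fun j => W (σ.symm j)
  have hdvd_high : ∀ j, σ.symm j ∉ low → p ^ (D + 1) ∣ ballWt p k d (Wc j) := by
    intro j hj
    exact Finset.dvd_sum fun x hx => pow_dvd_pow p (hhigh _ hj x hx)
  have hdvd_low : ∀ j, σ.symm j ∈ low → p ^ (d (c (σ.symm j)) + 1) ∣ ballWt p k d (T (σ.symm j)) := by
    intro j hj
    exact Finset.dvd_sum fun x hx => pow_dvd_pow p ((hlow _ hj).2.2.2 x hx)
  have hwt_low : ∀ j, σ.symm j ∈ low →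
      ballWt p k d (Wc j) = p ^ d (c (σ.symm j)) + ballWt p k d (T (σ.symm j)) := by
    intro j hj
    obtain ⟨hW, hc, -, -⟩ := hlow _ hj
    show ballWt p k d (W (σ.symm j)) = _
    rw [hW, ballWt, ballWt, Finset.sum_insert hc]
  -- the reindexed matrix mapped to `R[T]`, as blocks in the ROWS (columns: the same equivalence, no meaning)
  set PM : Matrix (Ball n (e + 1) ⊕ Ball n e) (Ball n (e + 1) ⊕ Ball n e) (Polynomial (MvPolynomial (Fin (n + 1)) (ZMod p))) :=
    ψ.toRingEquiv.toRingHom.mapMatrix (Matrix.reindex σ σ M) with hPM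
  have hdetPM : PM.det = ψ M.det := by
    rw [hPM, ← RingHom.map_det, Matrix.det_reindex_self]; rfl
  have hψX : ψ (X 0) = Polynomial.X := by rw [hψ]; exact MvPolynomial.finSuccEquiv_X_zero
  have hentry : ∀ i j, PM i j = ψ (ballEta p (n + 1) (σ.symm i).1 ^ ballWt p k d (Wc j)) := by
    intro i j
    simp only [hPM, RingHom.mapMatrix_apply, Matrix.map_apply, Matrix.reindex_apply, Matrix.submatrix_apply, hMdef,
      Matrix.of_apply, Wc]
    rfl
  have hPtop : ∀ (S' : Ball n (e + 1)) j, PM (Sum.inl S') j = Polynomial.C (ballEta p n S'.1 ^ ballWt p k d (Wc j)) := by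
    intro S' j
    rw [hentry, hσ, ballSplit_symm_inl, ballEta_map_succEmb, map_pow, finSuccEquiv_rename_succ, ← map_pow]
  have hPbot : ∀ (S' : Ball n e) j, PM (Sum.inr S') j =
      (Polynomial.X + Polynomial.C (ballEta p n S'.1)) ^ ballWt p k d (Wc j) := by
    intro S' j
    rw [hentry, hσ, ballSplit_symm_inr, ballEta_insert_zero, map_pow, map_add, hψX, finSuccEquiv_rename_succ]
  -- row differencing
  set E : Matrix (Ball n e) (Ball n (e + 1)) (Polynomial (MvPolynomial (Fin (n + 1)) (ZMod p))) :=
    Matrix.of fun S' T' => if T' = ballIncl n e S' then 1 else 0 with hE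
  set L : Matrix (Ball n (e + 1) ⊕ Ball n e) (Ball n (e + 1) ⊕ Ball n e) (Polynomial (MvPolynomial (Fin (n + 1)) (ZMod p))) :=
    Matrix.fromBlocks 1 0 (-E) 1 with hL
  have hdetL : L.det = 1 := by rw [hL, Matrix.det_fromBlocks_zero₁₂, Matrix.det_one, Matrix.det_one, mul_one]
  have hEmul : ∀ {κ : Type} (N : Matrix (Ball n (e + 1)) κ (Polynomial (MvPolynomial (Fin (n + 1)) (ZMod p)))) S' j,
      (E * N) S' j = N (ballIncl n e S') j := by
    intro κ N S' j
    rw [Matrix.mul_apply, Finset.sum_eq_single (ballIncl n e S')]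
    · simp [hE]
    · intro T' _ hT'; simp [hE, hT']
    · intro h; exact absurd (Finset.mem_univ _) h
  have hLP : L * PM = Matrix.fromBlocks PM.toBlocks₁₁ PM.toBlocks₁₂ (PM.toBlocks₂₁ - E * PM.toBlocks₁₁)
      (PM.toBlocks₂₂ - E * PM.toBlocks₁₂) := by
    conv_lhs => rw [← Matrix.fromBlocks_toBlocks PM, hL, Matrix.fromBlocks_multiply]
    simp only [Matrix.one_mul, Matrix.zero_mul, add_zero, Matrix.neg_mul]
    congr 1 <;> abel
  have hLP_top : ∀ (S' : Ball n (e + 1)) j, (L * PM) (Sum.inl S') j = PM (Sum.inl S') j := by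
    intro S' j
    rw [hLP]
    rcases j with V | V
    · rw [Matrix.fromBlocks_apply₁₁]; rfl
    · rw [Matrix.fromBlocks_apply₁₂]; rfl
  have hLP_bot : ∀ (S' : Ball n e) j, (L * PM) (Sum.inr S') j = PM (Sum.inr S') j - PM (Sum.inl (ballIncl n e S')) j := by
    intro S' j
    rw [hLP]
    rcases j with V | V
    · rw [Matrix.fromBlocks_apply₂₁, Matrix.sub_apply, hEmul]; rfl
    · rw [Matrix.fromBlocks_apply₂₂, Matrix.sub_apply, hEmul]; rfl
  -- the column weights `v` and row weights `u`
  let v : Ball n (e + 1) ⊕ Ball n e → ℕ := fun j => if σ.symm j ∈ low then p ^ d (c (σ.symm j)) else P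
  have hvP : ∀ j, v j ≤ P := by
    intro j; by_cases hj : σ.symm j ∈ low
    · simp only [v, hj, if_true, hP]; exact Nat.pow_le_pow_right (Fact.out : p.Prime).one_lt.le (hlow _ hj).2.2.1
    · simp only [v, hj, if_false]; exact le_rfl
  -- the rescaled matrix `N'`, entrywise
  have hN' : ∀ i j, ∃ g : Polynomial (MvPolynomial (Fin (n + 1)) (ZMod p)),
      Polynomial.X ^ (Sum.elim (fun _ => P) (fun _ => 0) i) * (L * PM) i j = g * Polynomial.X ^ v j ∧
      Polynomial.eval 0 g = (Matrix.of fun (i : Ball n (e + 1) ⊕ Ball n e) (j : Ball (n + 1) (e + 1)) =>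
        Sum.elim (fun S : Ball n (e + 1) =>
            if j ∉ low ∨ d (c j) = D then ballEta p n S.1 ^ ballWt p k d (W j) else 0)
          (fun S' : Ball n e => if j ∈ low then ballEta p n S'.1 ^ ballWt p k d (T j) else 0) i) i (σ.symm j) := by
    rintro (S | S') j
    · -- plain row: `T^P · C a = (C a · T^(P - v j)) · T^(v j)`
      refine ⟨Polynomial.C (ballEta p n S.1 ^ ballWt p k d (Wc j)) * Polynomial.X ^ (P - v j), ?_, ?_⟩
      · rw [Sum.elim_inl, hLP_top, hPtop, mul_assoc, ← pow_add, Nat.sub_add_cancel (hvP j), mul_comm]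
      · rw [Matrix.of_apply, Sum.elim_inl, Polynomial.eval_mul, Polynomial.eval_C, Polynomial.eval_pow,
          Polynomial.eval_X]
        by_cases hj : σ.symm j ∈ low
        · by_cases hD : d (c (σ.symm j)) = D
          · have : v j = P := by simp only [v, hj, if_true, hD, hP]
            rw [this, Nat.sub_self, pow_zero, mul_one, if_pos (Or.inr hD)]
          · have hlt : v j < P := by
              have : d (c (σ.symm j)) < D := lt_of_le_of_ne (hlow _ hj).2.2.1 hD
              simp only [v, hj, if_true, hP]
              exact Nat.pow_lt_pow_right (Fact.out : p.Prime).one_lt this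
            rw [zero_pow (by omega), mul_zero, if_neg (by push Not; exact ⟨hj, hD⟩)]
        · have : v j = P := by simp only [v, hj, if_false]
          rw [this, Nat.sub_self, pow_zero, mul_one, if_pos (Or.inl hj)]
    · -- difference row
      rw [Sum.elim_inr, pow_zero, one_mul, hLP_bot, hPbot, hPtop, Matrix.of_apply, Sum.elim_inr,
        show (ballIncl n e S').1 = S'.1 from rfl]
      by_cases hj : σ.symm j ∈ low
      · obtain ⟨g, hg⟩ := add_pow_sub_eq_X_pow_mul p (R := MvPolynomial (Fin (n + 1)) (ZMod p)) (d (c (σ.symm j))) _ (hdvd_low j hj) (ballEta p n S'.1)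
        refine ⟨Polynomial.C (ballEta p n S'.1 ^ ballWt p k d (T (σ.symm j))) + Polynomial.X * g, ?_, ?_⟩
        · have hv : v j = p ^ d (c (σ.symm j)) := by simp only [v, hj, if_true]
          rw [hv, hwt_low j hj, hg, mul_comm]
        · simp [hj]
      · obtain ⟨g₀, hg₀⟩ := X_pow_dvd_add_pow_sub p (R := MvPolynomial (Fin (n + 1)) (ZMod p)) D _ (hdvd_high j hj) (ballEta p n S'.1)
        have h1 : p ^ D + 1 ≤ p ^ (D + 1) := Nat.pow_lt_pow_right (Fact.out : p.Prime).one_lt (by omega)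
        obtain ⟨r, hr⟩ := Nat.exists_eq_add_of_le h1
        refine ⟨Polynomial.X ^ (r + 1) * g₀, ?_, ?_⟩
        · have hv : v j = P := by simp only [v, hj, if_false]
          rw [hv, hg₀, hr, hP]; ring
        · simp [hj]
  choose N' hN'1 hN'2 using hN'
  -- the matrix identity `diag(T^u) * (L * PM) = N' * diag(T^v)`
  have hident : Matrix.diagonal (fun i => Polynomial.X ^ (Sum.elim (fun _ => P) (fun _ => 0) i)) * (L * PM) =
      Matrix.of N' * Matrix.diagonal (fun j => Polynomial.X ^ v j) := by
    refine Matrix.ext fun i j => ?_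
    rw [Matrix.diagonal_mul, Matrix.mul_diagonal, Matrix.of_apply]
    exact hN'1 i j
  -- evaluation at `0`
  have heval : (Polynomial.evalRingHom (0 : MvPolynomial (Fin (n + 1)) (ZMod p))).mapMatrix (Matrix.of N') =
      (Matrix.of fun (i : Ball n (e + 1) ⊕ Ball n e) (j : Ball (n + 1) (e + 1)) =>
        Sum.elim (fun S : Ball n (e + 1) =>
            if j ∉ low ∨ d (c j) = D then ballEta p n S.1 ^ ballWt p k d (W j) else 0)
          (fun S' : Ball n e => if j ∈ low then ballEta p n S'.1 ^ ballWt p k d (T j) else 0) i).submatrix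
        id σ.symm := by
    refine Matrix.ext fun i j => ?_
    rw [RingHom.mapMatrix_apply, Matrix.map_apply, Matrix.of_apply, Matrix.submatrix_apply]
    exact hN'2 i j
  have hdetN' : (Matrix.of N').det ≠ 0 := by
    intro h0
    apply hM
    rw [← heval, ← RingHom.map_det, h0, map_zero]
  -- determinants
  have hdet := congrArg Matrix.det hident
  simp only [Matrix.det_mul, Matrix.det_diagonal, hdetL, one_mul] at hdet
  intro hM0
  have hPM0 : PM.det = 0 := by rw [hdetPM, hM0, map_zero]
  rw [hPM0, mul_zero] at hdet
  have hX : (∏ j, Polynomial.X ^ v j : Polynomial (MvPolynomial (Fin (n + 1)) (ZMod p))) ≠ 0 :=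
    Finset.prod_ne_zero_iff.mpr fun j _ => pow_ne_zero _ Polynomial.X_ne_zero
  exact hdetN' ((mul_eq_zero.mp hdet.symm).resolve_right hX)

end

end Summit.ValiantsHypothesis.ValiantsHypothesis.Theorems.BarrierLever.FrobeniusDoor
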